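import Mathlib

/-!
# Thin-set flattening lemma (abstract, product form)

On a finite measure space, a density `f` pinched a.e. between `m` and `m(1+η)` (`m, η ≥ 0`) tilts no a.e.
`C`-bounded test `g` by more than `2ηCm·ν(univ)²`, in product form (no division, no normalisation):
`|(∫ g f dν)·ν(univ) − (∫ g dν)(∫ f dν)| ≤ 2 η C m ν(univ)²`.

Proof: subtract the constant `m` inside both integrals (the `m`-terms cancel exactly), then bound the two
remaining products by `norm_integral_le_of_norm_le_const` and the triangle inequality.
-/

open MeasureTheory Set

namespace Summit.AtomisticToContinuum.HydrodynamicLimit.Theorems.ImpactDiscFlatteningLine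

/-- FLATTENING (abstract thin-set flattening lemma, product form): on a finite measure space, if
`m ≤ f ≤ m(1+η)` a.e. (`m, η ≥ 0`) and `|g| ≤ C` a.e., then
`|(∫ g f dν)·ν(univ) − (∫ g dν)(∫ f dν)| ≤ 2 η C m ν(univ)²`. -/
theorem stub_flattening {E : Type*} [MeasurableSpace E] (ν : Measure E) [IsFiniteMeasure ν] (f g : E → ℝ) (m η C : ℝ)
    (hm : 0 ≤ m) (hη : 0 ≤ η) (hC : 0 ≤ C) (hf : AEStronglyMeasurable f ν) (hg : AEStronglyMeasurable g ν)
    (hpinch : ∀ᵐ x ∂ν, m ≤ f x ∧ f x ≤ m * (1 + η)) (hbound : ∀ᵐ x ∂ν, |g x| ≤ C) :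
    |(∫ x, g x * f x ∂ν) * ν.real Set.univ - (∫ x, g x ∂ν) * (∫ x, f x ∂ν)| ≤
      2 * η * C * m * ν.real Set.univ ^ 2 := by
  have hV0 : 0 ≤ ν.real Set.univ := measureReal_nonneg
  have hgnorm : ∀ᵐ x ∂ν, ‖g x‖ ≤ C := by
    filter_upwards [hbound] with x hx
    rw [Real.norm_eq_abs]
    exact hx
  -- integrability of `f`, `g`, `g * f`
  have hf_int : Integrable f ν := by
    refine Integrable.mono' (integrable_const (m * (1 + η))) hf ?_
    filter_upwards [hpinch] with x hx
    rw [Real.norm_eq_abs, abs_of_nonneg (hm.trans hx.1)]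
    exact hx.2
  have hg_int : Integrable g ν := Integrable.mono' (integrable_const C) hg hgnorm
  have hgf_int : Integrable (fun x => g x * f x) ν := hf_int.bdd_mul hg hgnorm
  -- subtracting the constant `m`: the `m`-terms cancel
  have h1 : ∫ x, g x * (f x - m) ∂ν = ∫ x, g x * f x ∂ν - m * ∫ x, g x ∂ν := by
    have hfun : (fun x => g x * (f x - m)) = fun x => g x * f x - m * g x := by
      funext x
      ring
    rw [hfun, integral_sub hgf_int (hg_int.const_mul m), integral_const_mul]
  have h2 : ∫ x, (f x - m) ∂ν = ∫ x, f x ∂ν - m * ν.real Set.univ := by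
    rw [integral_sub hf_int (integrable_const m), integral_const, smul_eq_mul, mul_comm]
  have key : (∫ x, g x * f x ∂ν) * ν.real Set.univ - (∫ x, g x ∂ν) * (∫ x, f x ∂ν) =
      (∫ x, g x * (f x - m) ∂ν) * ν.real Set.univ - (∫ x, g x ∂ν) * (∫ x, (f x - m) ∂ν) := by
    rw [h1, h2]
    ring
  -- the three elementary bounds
  have b1 : |∫ x, g x * (f x - m) ∂ν| ≤ C * (m * η) * ν.real Set.univ := by
    have h := norm_integral_le_of_norm_le_const (μ := ν) (f := fun x => g x * (f x - m))
      (C := C * (m * η)) ?_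
    · simpa only [Real.norm_eq_abs] using h
    filter_upwards [hpinch, hbound] with x hx hx'
    rw [Real.norm_eq_abs, abs_mul, abs_of_nonneg (sub_nonneg.mpr hx.1)]
    exact mul_le_mul hx' (by linarith [hx.2]) (sub_nonneg.mpr hx.1) hC
  have b2 : |∫ x, g x ∂ν| ≤ C * ν.real Set.univ := by
    simpa only [Real.norm_eq_abs] using norm_integral_le_of_norm_le_const hgnorm
  have b3 : |∫ x, (f x - m) ∂ν| ≤ m * η * ν.real Set.univ := by
    have h := norm_integral_le_of_norm_le_const (μ := ν) (f := fun x => f x - m) (C := m * η) ?_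
    · simpa only [Real.norm_eq_abs] using h
    filter_upwards [hpinch] with x hx
    rw [Real.norm_eq_abs, abs_of_nonneg (sub_nonneg.mpr hx.1)]
    linarith [hx.2]
  rw [key]
  calc |(∫ x, g x * (f x - m) ∂ν) * ν.real Set.univ - (∫ x, g x ∂ν) * (∫ x, (f x - m) ∂ν)|
      ≤ |(∫ x, g x * (f x - m) ∂ν) * ν.real Set.univ| + |(∫ x, g x ∂ν) * (∫ x, (f x - m) ∂ν)| :=
        abs_sub _ _
    _ = |∫ x, g x * (f x - m) ∂ν| * ν.real Set.univ + |∫ x, g x ∂ν| * |∫ x, (f x - m) ∂ν| := by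
        rw [abs_mul, abs_mul, abs_of_nonneg hV0]
    _ ≤ C * (m * η) * ν.real Set.univ * ν.real Set.univ
          + C * ν.real Set.univ * (m * η * ν.real Set.univ) := by
        have e1 : |∫ x, g x * (f x - m) ∂ν| * ν.real Set.univ ≤
            C * (m * η) * ν.real Set.univ * ν.real Set.univ :=
          mul_le_mul_of_nonneg_right b1 hV0
        have e2 : |∫ x, g x ∂ν| * |∫ x, (f x - m) ∂ν| ≤
            C * ν.real Set.univ * (m * η * ν.real Set.univ) :=
          mul_le_mul_of_nonneg b2 b3 (abs_nonneg _) (mul_nonneg (mul_nonneg hm hη) hV0)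
        linarith
    _ = 2 * η * C * m * ν.real Set.univ ^ 2 := by ring

end Summit.AtomisticToContinuum.HydrodynamicLimit.Theorems.ImpactDiscFlatteningLine
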